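import Mathlib
import HarnessLib
import Literature.Analysis.FluidPDE.WholeSpaceIBP
import Summits.NavierStokesRegularity.NavierStokesRegularity.Theorems.ChiralWindowDoorClassDerivDecay
import Summits.NavierStokesRegularity.NavierStokesRegularity.Theorems.SelfStrainDoorCubicCalculus

/-!
# Door S22 «SelfStrainDoor» (nsreg-p1 ROUND-21; THEOREMS-ONLY landing) — file 3/5: THE WINDOWED CUBIC BUDGET (G1)

Texts and proofs of nsreg-p1 g18 `P1/r21/S22EndToEnd.lean` 9b9b0bcc57046adf (section `G1`, Stages 4–5), landed verbatim up
to namespacing (lane `ns-pressure-K2-p1` g5, DIRECTOR-NS g9 #60 (1)).  WHY THE RESIDUE K2 OF DOOR S22 CLOSES: on a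
self-strain-free slice `⟨v⟩v` is divergence-free (`…SelfStrainDoorCubicCalculus.divergence_jb_smul`), so in the windowed
cubic budget `d/dt ∫ a φ₁(v) = ∫ a⟪⟨v⟩v, Δv⟫ − ∫ a⟪⟨v⟩v, (v·∇)v⟫ − ∫ a⟪⟨v⟩v, ∇q⟫` the transport term is `∫ a⟨v⟩σ(v) = 0`,
the pressure term is `∫ q⟨v⟩∇a·v` (`div ψ = ⟨v⟩∇a·v`), and the viscous term is `≤` a cutoff term (Green + the two definite
terms dropped): EVERY surviving term lives on the annulus `1 ≤ ‖x‖ ≤ 2`, where the class bounds `‖v‖ ≤ D`, `|q| ≤ K`,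
`‖∇v‖ ≤ K` (`…ChiralWindowDoorClassDerivDecay.pressureDecay_of_class`) make it `O(1)`:

* `slice_budget` — for a `C²` divergence-free self-strain-free slice solving `d + (u·∇)u = Δu − ∇p` with annulus bounds and
  a cutoff `a` (`∇a = 0` on `B₁`, `a = 0` off `B̄₂`): `∫ a⟨u⟩⟪u, d⟫ ≤ 4(D+1)KD ∫‖∇a‖`;
* `cubicBudget` (**G1**) — for a door-class profile with self-strain-free slices and `a = bumpSq η 1`:
  `∫ a φ₁(v t₀) ≤ ∫ a φ₁(v t₁) + c (t₀ − t₁)` for `−2 ≤ t₁ ≤ t₀ < 0` (mean-value inequality on `(−∞,0)` with the derivative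
  of file 2 and the slice budget).

WHAT THIS IS NOT: not NS regularity; the budget of the residue K2 of a CONDITIONAL door (bears_on LADDER-NS N0, door S22).
-/

noncomputable section

-- the summit and its single sub-problem share the name (CONVENTIONS §1), as in every Theorems file
set_option linter.dupNamespace false

namespace Summit.NavierStokesRegularity.NavierStokesRegularity.Theorems.SelfStrainDoorCubicBudget

open MeasureTheory Set Function Filter Topology TopologicalSpace Metric InnerProductSpace
open scoped RealInnerProductSpace InnerProductSpace Laplacian ContDiff
open Literature.Analysis Literature.Analysis.FluidPDE
open Summit.NavierStokesRegularity.NavierStokesRegularity.Theorems.ChiralWindowDoorDefs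
open Summit.NavierStokesRegularity.NavierStokesRegularity.Theorems.ChiralWindowDoorClassDerivDecay
open Summit.NavierStokesRegularity.NavierStokesRegularity.Theorems.SelfStrainDoorDefs
open Summit.NavierStokesRegularity.NavierStokesRegularity.Theorems.ChiralWindowDoorLocalHelicityLower
  (contDiff_bumpSq continuous_bumpSq hasCompactSupport_bumpSq)
open Summit.NavierStokesRegularity.NavierStokesRegularity.Theorems.SelfStrainDoorCubicCalculus

/-! ## Stage 4: the slice budget `∫ a ⟨u⟩⟪u, ∂ₜu⟫ ≤ 4 (D+1) K D ∫ ‖∇a‖` -/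

/-- **The slice budget.**  For a `C²` divergence-free, self-strain-free slice `u` solving `d + (u·∇)u = Δu − ∇p` with annulus
bounds `‖u‖ ≤ D`, `|p| ≤ K`, `‖∇u‖ ≤ K` on `‖x‖ ≥ 1`, and a cutoff `a ≥ 0` with `∇a = 0` on the unit ball and `a = 0` off
`closedBall 0 2`: `∫ a ⟨u⟩ ⟪u, d⟫ ≤ 4 (D+1) K D ∫ ‖∇a‖`.  (Step 1: the integrand is `⟪Δu, ψ⟫ − ⟪∇p, ψ⟫` because the
transport term `a⟨u⟩σ(u)` vanishes; Step 3: Green `∫⟪Δu, ψ⟫ = −∑ᵢ∫⟪∂ᵢu, ∂ᵢψ⟫` and `neg_inner_fderiv_psi_le`; Step 4: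
`−∫⟪∇p, ψ⟫ = ∫ p div ψ = ∫ p⟨u⟩∇a·u` by `divergence_psi`.) -/
theorem slice_budget {u d : (EuclideanSpace ℝ (Fin 3)) → (EuclideanSpace ℝ (Fin 3))} {p : (EuclideanSpace ℝ (Fin 3)) → ℝ} {a : (EuclideanSpace ℝ (Fin 3)) → ℝ} {D K : ℝ}
    (hu : ContDiff ℝ 2 u) (hp : ContDiff ℝ 1 p) (ha2 : ContDiff ℝ 2 a)
    (ha0 : ∀ x, 0 ≤ a x) (hazero : ∀ x, 2 < ‖x‖ → a x = 0) (hDa_in : ∀ x, ‖x‖ < 1 → fderiv ℝ a x = 0)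
    (hmom : ∀ x, d x + convect u u x = (Δ u) x - gradient p x)
    (hdiv : ∀ x, VectorCalculus.divergence u x = 0) (hσ : ∀ x, selfStrain u x = 0)
    (hD0 : 0 ≤ D) (hK0 : 0 ≤ K)
    (huD : ∀ x, 1 ≤ ‖x‖ → ‖u x‖ ≤ D) (hpK : ∀ x, 1 ≤ ‖x‖ → |p x| ≤ K)
    (hDu : ∀ x, 1 ≤ ‖x‖ → ‖fderiv ℝ u x‖ ≤ K) :
    ∫ x, a x * (jb (u x) * ⟪u x, d x⟫) ≤ 4 * ((D + 1) * K * D) * ∫ x, ‖fderiv ℝ a x‖ := by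
  have ha1 : ContDiff ℝ 1 a := ha2.of_le one_le_two
  have hu1 : ContDiff ℝ 1 u := hu.of_le one_le_two
  have hadiff : ∀ x, DifferentiableAt ℝ a x := fun x => ha1.differentiable (by norm_num) x
  have hudiff : ∀ x, DifferentiableAt ℝ u x := fun x => hu1.differentiable (by norm_num) x
  have hDa_out : ∀ x, 2 < ‖x‖ → fderiv ℝ a x = 0 := fun x hx => fderiv_eq_zero_of_two_lt hazero hx
  -- compact support helper
  have hcs : ∀ {F : Type} [NormedAddCommGroup F] (f : (EuclideanSpace ℝ (Fin 3)) → F), (∀ x, 2 < ‖x‖ → f x = 0) → HasCompactSupport f :=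
    fun f hf => HasCompactSupport.intro (isCompact_closedBall (0 : (EuclideanSpace ℝ (Fin 3))) 2) fun x hx =>
      hf x (by rwa [mem_closedBall_zero_iff, not_le] at hx)
  -- the test field
  have hψ1 : ContDiff ℝ 1 (psi a u) := by
    have hψ : psi a u = fun y => (a y * jb (u y)) • u y := rfl
    rw [hψ]
    exact (ha1.mul (contDiff_jb_comp hu1)).smul hu1
  have hψzero : ∀ x, 2 < ‖x‖ → psi a u x = 0 := fun x hx => by simp [psi, hazero x hx]
  have hψc : HasCompactSupport (psi a u) := hcs _ hψzero
  have hDψ_out : ∀ x, 2 < ‖x‖ → fderiv ℝ (psi a u) x = 0 := fun x hx => fderiv_eq_zero_of_two_lt hψzero hx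
  -- Step 1: the integrand is `⟪Δu, ψ⟫ - ⟪∇p, ψ⟫`
  have hpt : ∀ x, a x * (jb (u x) * ⟪u x, d x⟫) = ⟪(Δ u) x, psi a u x⟫ - ⟪gradient p x, psi a u x⟫ := by
    intro x
    have hσx : ⟪u x, convect u u x⟫ = 0 := hσ x
    have hm : d x = (Δ u) x - gradient p x - convect u u x := eq_sub_of_add_eq (hmom x)
    have e1 : ⟪(Δ u) x, psi a u x⟫ = a x * jb (u x) * ⟪u x, (Δ u) x⟫ := by
      simp only [psi, real_inner_smul_right]
      rw [real_inner_comm]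
    have e2 : ⟪gradient p x, psi a u x⟫ = a x * jb (u x) * ⟪u x, gradient p x⟫ := by
      simp only [psi, real_inner_smul_right]
      rw [real_inner_comm]
    rw [e1, e2, hm, inner_sub_right, inner_sub_right, hσx]
    ring
  have hiV : Integrable fun x => ⟪(Δ u) x, psi a u x⟫ :=
    ((continuous_laplacian hu).inner hψ1.continuous).integrable_of_hasCompactSupport
      (hcs _ fun x hx => by simp [hψzero x hx])
  have hiP : Integrable fun x => ⟪gradient p x, psi a u x⟫ :=
    ((continuous_gradient_of_contDiff hp).inner hψ1.continuous).integrable_of_hasCompactSupport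
      (hcs _ fun x hx => by simp [hψzero x hx])
  have hJ : ∫ x, a x * (jb (u x) * ⟪u x, d x⟫)
      = (∫ x, ⟪(Δ u) x, psi a u x⟫) - ∫ x, ⟪gradient p x, psi a u x⟫ := by
    rw [← integral_sub hiV hiP]
    exact integral_congr_ae (Eventually.of_forall hpt)
  -- Step 2: the majorant `g = ‖∇a‖ (D+1) K D`
  have hgi : Integrable fun x => ‖fderiv ℝ a x‖ * ((D + 1) * K * D) :=
    (((ha1.continuous_fderiv (by norm_num)).norm).mul continuous_const).integrable_of_hasCompactSupport
      (hcs _ fun x hx => by simp [hDa_out x hx])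
  have hprod : ∀ x, ∀ w : (EuclideanSpace ℝ (Fin 3)), ‖w‖ ≤ ‖fderiv ℝ u x‖ →
      ‖fderiv ℝ a x‖ * (jb (u x) * ‖w‖ * ‖u x‖) ≤ ‖fderiv ℝ a x‖ * ((D + 1) * K * D) := by
    intro x w hw
    by_cases hx : ‖x‖ < 1
    · simp [hDa_in x hx]
    · push Not at hx
      refine mul_le_mul_of_nonneg_left ?_ (norm_nonneg _)
      have hjb : jb (u x) ≤ D + 1 := jb_le_of_norm_le hD0 (huD x hx)
      exact mul_le_mul (mul_le_mul hjb (hw.trans (hDu x hx)) (norm_nonneg _) (by positivity)) (huD x hx)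
        (norm_nonneg _) (by positivity)
  -- Step 3: the viscous term `∫ ⟪Δu, ψ⟫ ≤ 3 ∫ g`
  let b : OrthonormalBasis (Fin 3) ℝ (EuclideanSpace ℝ (Fin 3)) := EuclideanSpace.basisFun (Fin 3) ℝ
  have hb1 : ∀ i, ‖b i‖ = 1 := fun i => b.orthonormal.1 i
  have hG := integral_inner_laplacian_add_eq_zero b hu hψ1 (Or.inr hψc)
  have hterm : ∀ i, -∫ x, ‖fderiv ℝ a x‖ * ((D + 1) * K * D)
      ≤ ∫ x, ⟪fderiv ℝ u x (b i), fderiv ℝ (psi a u) x (b i)⟫ := by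
    intro i
    have hIi : Integrable fun x => ⟪fderiv ℝ u x (b i), fderiv ℝ (psi a u) x (b i)⟫ :=
      ((((hu.continuous_fderiv (by norm_num)).clm_apply continuous_const).inner
        ((hψ1.continuous_fderiv (by norm_num)).clm_apply continuous_const))).integrable_of_hasCompactSupport
        (hcs _ fun x hx => by simp [hDψ_out x hx])
    have hpw : ∀ x, -(‖fderiv ℝ a x‖ * ((D + 1) * K * D))
        ≤ ⟪fderiv ℝ u x (b i), fderiv ℝ (psi a u) x (b i)⟫ := by
      intro x
      have h1 := neg_inner_fderiv_psi_le (hadiff x) (hudiff x) (ha0 x) (hb1 i)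
      have h2 := hprod x (fderiv ℝ u x (b i)) (by simpa [hb1 i] using (fderiv ℝ u x).le_opNorm (b i))
      linarith
    rw [← integral_neg]
    exact integral_mono hgi.neg hIi hpw
  have hV : ∫ x, ⟪(Δ u) x, psi a u x⟫ ≤ 3 * ∫ x, ‖fderiv ℝ a x‖ * ((D + 1) * K * D) := by
    have hsum : ∑ i : Fin 3, (-∫ x, ‖fderiv ℝ a x‖ * ((D + 1) * K * D))
        ≤ ∑ i : Fin 3, ∫ x, ⟪fderiv ℝ u x (b i), fderiv ℝ (psi a u) x (b i)⟫ :=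
      Finset.sum_le_sum fun i _ => hterm i
    simp only [Finset.sum_const, Finset.card_univ, Fintype.card_fin, nsmul_eq_mul, Nat.cast_ofNat] at hsum
    linarith [hG]
  -- Step 4: the pressure term `-∫⟪∇p, ψ⟫ = ∫ p ⟨u⟩ ∇a·u ≤ ∫ g`
  have hdivψ : ∀ x, VectorCalculus.divergence (psi a u) x = jb (u x) * fderiv ℝ a x (u x) :=
    fun x => divergence_psi (hadiff x) (hudiff x) (hdiv x) (hσ x)
  have hPeq : ∫ x, ⟪gradient p x, psi a u x⟫ = -∫ x, p x * (jb (u x) * fderiv ℝ a x (u x)) := by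
    rw [integral_inner_gradient_eq_neg_integral_mul_divergence hp hψ1 hψc]
    congr 1
    exact integral_congr_ae (Eventually.of_forall fun x => by simp only [hdivψ x])
  have hP : ∫ x, p x * (jb (u x) * fderiv ℝ a x (u x)) ≤ ∫ x, ‖fderiv ℝ a x‖ * ((D + 1) * K * D) := by
    have hIl : Integrable fun x => p x * (jb (u x) * fderiv ℝ a x (u x)) :=
      (hp.continuous.mul ((continuous_jb.comp hu.continuous).mul
        ((ha1.continuous_fderiv (by norm_num)).clm_apply hu.continuous))).integrable_of_hasCompactSupport
        (hcs _ fun x hx => by simp [hDa_out x hx])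
    refine integral_mono hIl hgi fun x => ?_
    by_cases hx : ‖x‖ < 1
    · simp [hDa_in x hx]
    · push Not at hx
      have hj := jb_pos (u x)
      have h0 : |fderiv ℝ a x (u x)| ≤ ‖fderiv ℝ a x‖ * ‖u x‖ := by
        have h := (fderiv ℝ a x).le_opNorm (u x)
        rwa [Real.norm_eq_abs] at h
      have h1 : p x * (jb (u x) * fderiv ℝ a x (u x)) ≤ |p x| * (jb (u x) * (‖fderiv ℝ a x‖ * ‖u x‖)) := by
        have h := le_abs_self (p x * (jb (u x) * fderiv ℝ a x (u x)))
        rw [abs_mul, abs_mul, abs_of_pos hj] at h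
        exact h.trans (mul_le_mul_of_nonneg_left (mul_le_mul_of_nonneg_left h0 hj.le) (abs_nonneg _))
      have hjb : jb (u x) ≤ D + 1 := jb_le_of_norm_le hD0 (huD x hx)
      have h2 : jb (u x) * |p x| * ‖u x‖ ≤ (D + 1) * K * D :=
        mul_le_mul (mul_le_mul hjb (hpK x hx) (abs_nonneg _) (by positivity)) (huD x hx) (norm_nonneg _)
          (by positivity)
      calc p x * (jb (u x) * fderiv ℝ a x (u x))
          ≤ |p x| * (jb (u x) * (‖fderiv ℝ a x‖ * ‖u x‖)) := h1
        _ = ‖fderiv ℝ a x‖ * (jb (u x) * |p x| * ‖u x‖) := by ring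
        _ ≤ ‖fderiv ℝ a x‖ * ((D + 1) * K * D) := mul_le_mul_of_nonneg_left h2 (norm_nonneg _)
  -- Step 5: combine
  have hfin : ∫ x, ‖fderiv ℝ a x‖ * ((D + 1) * K * D) = (∫ x, ‖fderiv ℝ a x‖) * ((D + 1) * K * D) :=
    integral_mul_const _ _
  rw [hJ, hPeq]
  nlinarith [hV, hP, hfin]

/-! ## Stage 5: G1, the windowed cubic budget -/

/-- **G1 · THE WINDOWED CUBIC BUDGET.**  For a door-class profile (Type-I rate, space–time Type-I decay, continuity on the
open slab, unit-viscosity Oseen–Duhamel identity, divergence-free slices) with SELF-STRAIN-FREE slices and the cutoff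
`a = η²` (`η` admissible: `= 1` on `B₁`, supported in `B₂`), the regularised windowed cubic energy `∫ a φ₁(v(t))` grows at a
bounded rate on `(−∞, 0)`: there is `c` with `∫ a φ₁(v t₀) ≤ ∫ a φ₁(v t₁) + c (t₀ − t₁)` for `−2 ≤ t₁ ≤ t₀ < 0`
(`c = 4 (D+1) K D ∫ ‖∇a‖`, `K` the one constant of `pressureDecay_of_class`).  Proof: the classical representative with its
scale-invariant bounds (`pressureDecay_of_class`), the derivative of the functional (`hasDerivAt_cubicFunctional`), the slice
budget at every `t < 0` (`slice_budget`; annulus bounds from the class bounds since `‖x‖ + √(−t) ≥ 1` there), and the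
mean-value inequality on the convex set `(−∞,0)` (`Convex.image_sub_le_mul_sub_of_deriv_le`). -/
theorem cubicBudget : ∀ (η : EuclideanSpace ℝ (Fin 3) → ℝ), IsAdmissibleBump η →
    ∀ (C D : ℝ) (v : ℝ → EuclideanSpace ℝ (Fin 3) → EuclideanSpace ℝ (Fin 3)),
    HasTypeITimeDecay C v → HasTypeIDecay D v →
    ContinuousOn (Function.uncurry v) (Set.Iio (0 : ℝ) ×ˢ Set.univ) →
    (∀ s t : ℝ, s < t → t < 0 → ∀ x,
        v t x = UnboundedOperators.heatExtension (v s) (t - s) x - oseenDuhamel 1 s v v t x) →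
    (∀ t < 0, VectorCalculus.IsDivFree (v t)) →
    (∀ t < 0, IsSelfStrainFree (v t)) →
    ∃ c : ℝ, ∀ t₁ t₀ : ℝ, -2 ≤ t₁ → t₁ ≤ t₀ → t₀ < 0 →
      ∫ x, bumpSq η 1 x * cubeReg (v t₀ x) ≤ (∫ x, bumpSq η 1 x * cubeReg (v t₁ x)) + c * (t₀ - t₁) := by
  intro η hη C D v hC hD hcont hmild hdiv hσ
  obtain ⟨q, K, hsol, hK⟩ := pressureDecay_of_class C D v hC hD hcont hmild hdiv
  -- signs of the constants
  have hD0 : 0 ≤ D := by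
    by_contra hneg
    push Not at hneg
    have h1 := hD (-1) (by norm_num) 0
    have hpos : 0 < ‖(0 : (EuclideanSpace ℝ (Fin 3)))‖ + Real.sqrt (-(-1 : ℝ)) := by simp
    have h2 : D / (‖(0 : (EuclideanSpace ℝ (Fin 3)))‖ + Real.sqrt (-(-1 : ℝ))) < 0 := div_neg_of_neg_of_pos hneg hpos
    linarith [norm_nonneg (v (-1) 0)]
  have hK0 : 0 ≤ K := le_trans (by positivity) (hK (-1) (by norm_num) 0).1
  -- Stage 3: the functional is differentiable on `(−∞, 0)`
  have hsm := hsol.smooth_velocity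
  have hderivK : ∀ t < (0 : ℝ), ∀ x : (EuclideanSpace ℝ (Fin 3)), (‖x‖ + Real.sqrt (-t)) ^ 3 * ‖deriv (fun τ => v τ x) t‖ ≤ K :=
    fun t ht x => (hK t ht x).2.2.2.2
  have hI : ∀ t₀ < (0 : ℝ), HasDerivAt (fun t => ∫ x, bumpSq η 1 x * cubeReg (v t x))
      (∫ x, bumpSq η 1 x * (jb (v t₀ x) * ⟪v t₀ x, deriv (fun τ => v τ x) t₀⟫)) t₀ :=
    fun t₀ ht₀ => hasDerivAt_cubicFunctional hsm hC hderivK (continuous_bumpSq hη 1)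
      (hasCompactSupport_bumpSq hη one_pos) (bumpSq_nonneg η 1) ht₀
  -- Stage 4: the derivative is bounded above, uniformly in `t < 0`
  have hJ : ∀ t < (0 : ℝ), ∫ x, bumpSq η 1 x * (jb (v t x) * ⟪v t x, deriv (fun τ => v τ x) t⟫)
      ≤ 4 * ((D + 1) * K * D) * ∫ x, ‖fderiv ℝ (bumpSq η 1) x‖ := by
    intro t ht
    have hu : ContDiff ℝ 2 (v t) := (hsol.contDiff_velocity ht).of_le (by norm_cast)
    have hp : ContDiff ℝ 1 (q t) := (hsol.contDiff_pressure ht).of_le (by norm_cast)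
    have hmom : ∀ x, deriv (fun τ => v τ x) t + convect (v t) (v t) x = (Δ (v t)) x - gradient (q t) x := by
      intro x
      have h := hsol.momentum t ht x
      rw [timeDerivWithin_eq_deriv isOpen_Iio ht] at h
      simpa using h
    have hdivt : ∀ x, VectorCalculus.divergence (v t) x = 0 := hsol.divFree t ht
    have hσt : ∀ x, selfStrain (v t) x = 0 := hσ t ht
    have hbase : ∀ x : (EuclideanSpace ℝ (Fin 3)), 1 ≤ ‖x‖ → 1 ≤ ‖x‖ + Real.sqrt (-t) := fun x hx => by
      linarith [Real.sqrt_nonneg (-t)]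
    have huD : ∀ x : (EuclideanSpace ℝ (Fin 3)), 1 ≤ ‖x‖ → ‖v t x‖ ≤ D := fun x hx =>
      (hD t ht x).trans (div_le_self hD0 (hbase x hx))
    have hpK : ∀ x : (EuclideanSpace ℝ (Fin 3)), 1 ≤ ‖x‖ → |q t x| ≤ K := by
      intro x hx
      have h := (hK t ht x).1
      have h1 : 1 ≤ (‖x‖ + Real.sqrt (-t)) ^ 2 := one_le_pow₀ (hbase x hx)
      calc |q t x| = 1 * |q t x| := (one_mul _).symm
        _ ≤ (‖x‖ + Real.sqrt (-t)) ^ 2 * |q t x| := mul_le_mul_of_nonneg_right h1 (abs_nonneg _)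
        _ ≤ K := h
    have hDu : ∀ x : (EuclideanSpace ℝ (Fin 3)), 1 ≤ ‖x‖ → ‖fderiv ℝ (v t) x‖ ≤ K := by
      intro x hx
      have h := (hK t ht x).2.2.1
      have h1 : 1 ≤ (‖x‖ + Real.sqrt (-t)) ^ 2 := one_le_pow₀ (hbase x hx)
      calc ‖fderiv ℝ (v t) x‖ = 1 * ‖fderiv ℝ (v t) x‖ := (one_mul _).symm
        _ ≤ (‖x‖ + Real.sqrt (-t)) ^ 2 * ‖fderiv ℝ (v t) x‖ := mul_le_mul_of_nonneg_right h1 (norm_nonneg _)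
        _ ≤ K := h
    exact slice_budget hu hp (contDiff_bumpSq hη 1) (bumpSq_nonneg η 1)
      (fun x hx => bumpSq_eq_zero hη one_pos (by linarith))
      (fun x hx => fderiv_bumpSq_eq_zero_of_norm_lt_one hη hx) hmom hdivt hσt hD0 hK0 huD hpK hDu
  -- Stage 5: the mean-value inequality on the convex set `(−∞, 0)`
  refine ⟨4 * ((D + 1) * K * D) * ∫ x, ‖fderiv ℝ (bumpSq η 1) x‖, fun t₁ t₀ _ h10 ht₀ => ?_⟩
  have ht₁ : t₁ < 0 := lt_of_le_of_lt h10 ht₀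
  have hcontI : ContinuousOn (fun t => ∫ x, bumpSq η 1 x * cubeReg (v t x)) (Iio 0) :=
    fun t ht => (hI t ht).continuousAt.continuousWithinAt
  have hdiffI : DifferentiableOn ℝ (fun t => ∫ x, bumpSq η 1 x * cubeReg (v t x)) (interior (Iio 0)) := by
    rw [interior_Iio]
    exact fun t ht => (hI t ht).differentiableAt.differentiableWithinAt
  have hle : ∀ t ∈ interior (Iio (0 : ℝ)),
      deriv (fun t => ∫ x, bumpSq η 1 x * cubeReg (v t x)) t ≤ 4 * ((D + 1) * K * D) * ∫ x, ‖fderiv ℝ (bumpSq η 1) x‖ := by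
    rw [interior_Iio]
    intro t ht
    rw [(hI t ht).deriv]
    exact hJ t ht
  have h := (convex_Iio (0 : ℝ)).image_sub_le_mul_sub_of_deriv_le hcontI hdiffI hle t₁ ht₁ t₀ ht₀ h10
  linarith

end Summit.NavierStokesRegularity.NavierStokesRegularity.Theorems.SelfStrainDoorCubicBudget

end
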